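import Literature.AnabelianGeometry.AbsoluteAnabelian.ArchimedeanReconstruction
import Literature.AnabelianGeometry.AbsoluteAnabelian.AutHolomorphicSpacesPGL2RProofs
import Literature.AnabelianGeometry.AbsoluteAnabelian.AutHolomorphicSpacesChartDiscProofs
import Literature.AnabelianGeometry.AbsoluteAnabelian.ParallelogramsPlanarBasic
import HarnessLib

/-!
# [AbsTopIII] Cor. 2.7 (d) at `𝒜_𝕍(V^top)`: one-parameter subgroups of `Aut^hol` of a disc

PROOF-ONLY companion of `ArchimedeanReconstruction` (owner module, abc-iut L4-t12/t2; never edited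
here): the junction announced in S. Mochizuki, *Topics in absolute anabelian geometry III*, Cor. 2.7 (d)
p.59 — "Let `𝕍` be the Aut-holomorphic space determined by a parallelogram `V^top ⊆ E^top`.  Then the
one-parameter subgroups of the [topological] group `𝒜_𝕍(V^top)` [`≅ SL₂(ℝ)/{±1}` — cf. Proposition
2.2, (ii); Corollary 2.3, (i); the Riemann mapping theorem of elementary complex analysis] are
precisely the closed connected subgroups for which the complement of some connected open neighborhood
of the identity element fails to be connected."

The tree types the group-theoretic content as the named fact `OneParameterSubgroupsPSL2R` (repaired
reading A21-F8: two clauses, non-compact and compact one-parameter subgroups, for the concrete group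
`SL₂(ℝ)/{±1}`).  This file supplies the three printed "cf."s as kernel glue, with no new definitions:

* `oneParameterSubgroups_transfer` — both clauses are invariant under isomorphisms of topological
  groups `G ≃ₜ* H` (pure transport of structure);
* `oneParameterSubgroups_holAut_of` — for an Aut-holomorphic disc `X`, `Aut^hol(X)` (compact-open
  topology) satisfies both clauses, GIVEN the named fact `OneParameterSubgroupsPSL2R` (consumed BY
  NAME; its kernel proof is abc-iut-w5-d079's `oneParameterSubgroupsPSL2R_holds`), via Prop. 2.2 (ii)
  `discHolAutIsoPSL2R_holds` (`Aut^hol(X) ≅ SL₂(ℝ)/{±1}` as topological groups);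
* `isAutHolDisc_of_isSimplyConnected` / `isAutHolDisc_openParallelogram` — "the Riemann mapping
  theorem": a simply connected proper open `Ω ⊊ ℂ`, in particular a non-degenerate open parallelogram
  of the plane, is an Aut-holomorphic disc; whence `oneParameterSubgroups_holAut_openParallelogram_of`,
  the printed sentence for `V^top` a parallelogram of the complex plane (the chart picture of a
  parallelogram `V^top ⊆ E^top` of Cor. 2.7 (c)).

HONEST FRAMING: our kernel check of classical statements of a refereed paper; nothing here bears on
[IUTchIII] Cor. 3.12.  Bib key `MochizukiAbsTopIII2015`; locators = kurims manuscript pages.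
-/

noncomputable section

namespace Literature.AnabelianGeometry.AbsoluteAnabelian

open _root_.TopologicalSpace _root_.Topology _root_.Set _root_.Metric _root_.Function _root_.Filter
open scoped _root_.Manifold _root_.ContDiff
open Literature.Analysis.Complex

/-! ### Transport of the two clauses along isomorphisms of topological groups -/

namespace OneParameterTransfer

variable {G H : Type*} [Group G] [TopologicalSpace G] [Group H] [TopologicalSpace H]

/-- Ranges of continuous injective homomorphisms `ℝ → G` correspond, under an isomorphism of
topological groups `e : G ≃ₜ* H`, to ranges of continuous injective homomorphisms `ℝ → H`.
[cite: MochizukiAbsTopIII2015, Corollary 2.7 (d) p.59] -/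
theorem exists_injective_iff (e : G ≃ₜ* H) (S : Subgroup G) (T : Subgroup H)
    (hT : (T : Set H) = e '' (S : Set G)) :
    (∃ f : Multiplicative ℝ →* G, Continuous f ∧ Injective f ∧ f.range = S) ↔
      (∃ f : Multiplicative ℝ →* H, Continuous f ∧ Injective f ∧ f.range = T) := by
  constructor
  · rintro ⟨f, hfc, hfi, hfr⟩
    refine ⟨e.toMulEquiv.toMonoidHom.comp f, e.continuous.comp hfc, e.injective.comp hfi, ?_⟩
    apply SetLike.coe_injective
    rw [hT, MonoidHom.coe_range, MonoidHom.coe_comp, MulEquiv.coe_toMonoidHom, Set.range_comp,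
      ← MonoidHom.coe_range, hfr]
    rfl
  · rintro ⟨f, hfc, hfi, hfr⟩
    refine ⟨e.symm.toMulEquiv.toMonoidHom.comp f, e.symm.continuous.comp hfc,
      e.symm.injective.comp hfi, ?_⟩
    apply SetLike.coe_injective
    rw [MonoidHom.coe_range, MonoidHom.coe_comp, MulEquiv.coe_toMonoidHom, Set.range_comp,
      ← MonoidHom.coe_range, hfr, hT]
    show e.symm '' (e '' (S : Set G)) = S
    rw [Set.image_image]
    simp

/-- Ranges of continuous, non-injective, non-trivial homomorphisms `ℝ → G` correspond, under an
isomorphism of topological groups `e : G ≃ₜ* H`, to the same kind of ranges in `H`.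
[cite: MochizukiAbsTopIII2015, Corollary 2.7 (d) p.59] -/
theorem exists_not_injective_iff (e : G ≃ₜ* H) (S : Subgroup G) (T : Subgroup H)
    (hT : (T : Set H) = e '' (S : Set G)) :
    (∃ f : Multiplicative ℝ →* G, Continuous f ∧ ¬ Injective f ∧ f ≠ 1 ∧ f.range = S) ↔
      (∃ f : Multiplicative ℝ →* H, Continuous f ∧ ¬ Injective f ∧ f ≠ 1 ∧ f.range = T) := by
  constructor
  · rintro ⟨f, hfc, hfi, hf1, hfr⟩
    refine ⟨e.toMulEquiv.toMonoidHom.comp f, e.continuous.comp hfc, ?_, ?_, ?_⟩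
    · intro h
      exact hfi fun x y hxy => h (by simp [hxy])
    · intro h
      apply hf1
      refine MonoidHom.ext fun x => ?_
      have hx : e (f x) = 1 := by simpa using DFunLike.congr_fun h x
      exact EmbeddingLike.map_eq_one_iff.1 hx
    · apply SetLike.coe_injective
      rw [hT, MonoidHom.coe_range, MonoidHom.coe_comp, MulEquiv.coe_toMonoidHom, Set.range_comp,
        ← MonoidHom.coe_range, hfr]
      rfl
  · rintro ⟨f, hfc, hfi, hf1, hfr⟩
    refine ⟨e.symm.toMulEquiv.toMonoidHom.comp f, e.symm.continuous.comp hfc, ?_, ?_, ?_⟩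
    · intro h
      exact hfi fun x y hxy => h (by simp [hxy])
    · intro h
      apply hf1
      refine MonoidHom.ext fun x => ?_
      have hx : e.symm (f x) = 1 := by simpa using DFunLike.congr_fun h x
      exact EmbeddingLike.map_eq_one_iff.1 hx
    · apply SetLike.coe_injective
      rw [MonoidHom.coe_range, MonoidHom.coe_comp, MulEquiv.coe_toMonoidHom, Set.range_comp,
        ← MonoidHom.coe_range, hfr, hT]
      show e.symm '' (e '' (S : Set G)) = S
      rw [Set.image_image]
      simp

/-- `IsClosed` is transported. [cite: MochizukiAbsTopIII2015, Corollary 2.7 (d) p.59] -/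
theorem isClosed_iff (e : G ≃ₜ* H) (S : Subgroup G) (T : Subgroup H)
    (hT : (T : Set H) = e '' (S : Set G)) :
    IsClosed (S : Set G) ↔ IsClosed (T : Set H) := by
  rw [hT]
  exact (e.toHomeomorph.isClosed_image).symm

/-- `IsConnected` is transported. [cite: MochizukiAbsTopIII2015, Corollary 2.7 (d) p.59] -/
theorem isConnected_iff (e : G ≃ₜ* H) (S : Subgroup G) (T : Subgroup H)
    (hT : (T : Set H) = e '' (S : Set G)) :
    IsConnected (S : Set G) ↔ IsConnected (T : Set H) := by
  rw [hT]
  exact (e.toHomeomorph.isConnected_image).symm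

/-- The printed criterion "the complement of [the identity] fails to be connected", read inside the
subgroup, only depends on the subset `S ∖ {1}` of the ambient group.
[cite: MochizukiAbsTopIII2015, Corollary 2.7 (d) p.59] -/
theorem isPreconnected_univ_diff_one_iff (S : Subgroup G) :
    IsPreconnected ((univ : Set S) \ {1}) ↔ IsPreconnected ((S : Set G) \ {1}) := by
  have hset : ((↑) : S → G) '' ((univ : Set S) \ {1}) = (S : Set G) \ {1} := by
    ext g
    simp only [Set.mem_image, Set.mem_sdiff, Set.mem_univ, true_and, Set.mem_singleton_iff,
      SetLike.mem_coe]
    constructor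
    · rintro ⟨x, hx, rfl⟩
      exact ⟨x.2, fun h => hx (Subtype.ext (by simpa using h))⟩
    · rintro ⟨hg, hg1⟩
      exact ⟨⟨g, hg⟩, fun h => hg1 (by simpa using congrArg Subtype.val h), rfl⟩
  rw [← hset, Topology.IsInducing.subtypeVal.isPreconnected_image]

/-- The printed disconnectedness criterion is transported.
[cite: MochizukiAbsTopIII2015, Corollary 2.7 (d) p.59] -/
theorem not_isPreconnected_iff (e : G ≃ₜ* H) (S : Subgroup G) (T : Subgroup H)
    (hT : (T : Set H) = e '' (S : Set G)) :
    (¬ IsPreconnected ((univ : Set S) \ {1})) ↔ ¬ IsPreconnected ((univ : Set T) \ {1}) := by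
  rw [isPreconnected_univ_diff_one_iff, isPreconnected_univ_diff_one_iff, hT, not_iff_not]
  have himg : e '' ((S : Set G) \ {1}) = e '' (S : Set G) \ {1} := by
    rw [Set.image_sdiff e.injective, Set.image_singleton, map_one]
  rw [← himg]
  exact (e.toHomeomorph.isPreconnected_image).symm

/-- Being homeomorphic to a circle is transported.
[cite: MochizukiAbsTopIII2015, Corollary 2.7 (d) p.59] -/
theorem nonempty_homeomorph_circle_iff (e : G ≃ₜ* H) (S : Subgroup G) (T : Subgroup H)
    (hT : (T : Set H) = e '' (S : Set G)) :
    Nonempty (S ≃ₜ Circle) ↔ Nonempty (T ≃ₜ Circle) := by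
  have φ : (S : Set G) ≃ₜ (T : Set H) :=
    (e.toHomeomorph.image (S : Set G)).trans (Homeomorph.setCongr hT.symm)
  exact ⟨fun ⟨ψ⟩ => ⟨φ.symm.trans ψ⟩, fun ⟨ψ⟩ => ⟨φ.trans ψ⟩⟩

end OneParameterTransfer

open OneParameterTransfer in
/-- **Transport of the one-parameter-subgroup classification along isomorphisms of topological
groups.**  If `H` satisfies the two clauses of the repaired reading of Cor. 2.7 (d) — (1) ranges of
continuous injective homomorphisms `ℝ → H` = closed connected subgroups `T` with `T ∖ {1}`
disconnected; (2) ranges of continuous non-injective non-trivial homomorphisms `ℝ → H` = closed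
subgroups homeomorphic to a circle — and `e : G ≃ₜ* H`, then `G` satisfies them.
[cite: MochizukiAbsTopIII2015, Corollary 2.7 (d) p.59] -/
theorem oneParameterSubgroups_transfer {G H : Type*} [Group G] [TopologicalSpace G] [Group H]
    [TopologicalSpace H] (e : G ≃ₜ* H)
    (hH : (∀ T : Subgroup H,
        (∃ f : Multiplicative ℝ →* H, Continuous f ∧ Injective f ∧ f.range = T) ↔
        (IsClosed (T : Set H) ∧ IsConnected (T : Set H) ∧
          ¬ IsPreconnected ((univ : Set T) \ {1}))) ∧
      (∀ T : Subgroup H,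
        (∃ f : Multiplicative ℝ →* H, Continuous f ∧ ¬ Injective f ∧ f ≠ 1 ∧ f.range = T) ↔
        (IsClosed (T : Set H) ∧ Nonempty (T ≃ₜ Circle)))) :
    (∀ S : Subgroup G,
        (∃ f : Multiplicative ℝ →* G, Continuous f ∧ Injective f ∧ f.range = S) ↔
        (IsClosed (S : Set G) ∧ IsConnected (S : Set G) ∧
          ¬ IsPreconnected ((univ : Set S) \ {1}))) ∧
      (∀ S : Subgroup G,
        (∃ f : Multiplicative ℝ →* G, Continuous f ∧ ¬ Injective f ∧ f ≠ 1 ∧ f.range = S) ↔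
        (IsClosed (S : Set G) ∧ Nonempty (S ≃ₜ Circle))) := by
  obtain ⟨h1, h2⟩ := hH
  refine ⟨fun S => ?_, fun S => ?_⟩
  · have hT : ((S.map e.toMulEquiv.toMonoidHom : Subgroup H) : Set H) = e '' (S : Set G) :=
      Subgroup.coe_map _ _
    rw [exists_injective_iff e S _ hT, h1, isClosed_iff e S _ hT, isConnected_iff e S _ hT,
      not_isPreconnected_iff e S _ hT]
  · have hT : ((S.map e.toMulEquiv.toMonoidHom : Subgroup H) : Set H) = e '' (S : Set G) :=
      Subgroup.coe_map _ _
    rw [exists_not_injective_iff e S _ hT, h2, isClosed_iff e S _ hT,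
      nonempty_homeomorph_circle_iff e S _ hT]

/-! ### Cor. 2.7 (d) for `𝒜_𝕍(V^top) = Aut^hol(V)` of an Aut-holomorphic disc -/

section Disc

/-- **[AbsTopIII] Cor. 2.7 (d), first sentence, for an Aut-holomorphic disc** (modulo the named fact
`OneParameterSubgroupsPSL2R`, consumed BY NAME): for `X` an Aut-holomorphic disc, the group
`𝒜_𝕏(X^top) = Aut^hol(X)` (compact-open topology) satisfies both clauses of the repaired reading —
"the one-parameter subgroups … [`≅ SL₂(ℝ)/{±1}` — cf. Proposition 2.2, (ii)] are precisely the closed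
connected subgroups for which the complement of [the identity] fails to be connected", and the compact
one-parameter subgroups ("one-dimensional tori") are the closed subgroups homeomorphic to a circle.
Junction = Prop. 2.2 (ii) `discHolAutIsoPSL2R_holds` + transport `oneParameterSubgroups_transfer`.
[cite: MochizukiAbsTopIII2015, Corollary 2.7 (d) p.59] -/
theorem oneParameterSubgroups_holAut_of (h : OneParameterSubgroupsPSL2R)
    (X : Type) [TopologicalSpace X] [T2Space X] [ChartedSpace ℂ X] [IsManifold 𝓘(ℂ, ℂ) ω X]
    (hX : IsAutHolDisc X) :
    letI := homeoCompactOpen (⊤ : Opens X)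
    (∀ S : Subgroup (holAut (⊤ : Opens X)),
        (∃ f : Multiplicative ℝ →* holAut (⊤ : Opens X),
            Continuous f ∧ Injective f ∧ f.range = S) ↔
        (IsClosed (S : Set (holAut (⊤ : Opens X))) ∧ IsConnected (S : Set (holAut (⊤ : Opens X))) ∧
          ¬ IsPreconnected ((univ : Set S) \ {1}))) ∧
      (∀ S : Subgroup (holAut (⊤ : Opens X)),
        (∃ f : Multiplicative ℝ →* holAut (⊤ : Opens X),
            Continuous f ∧ ¬ Injective f ∧ f ≠ 1 ∧ f.range = S) ↔
        (IsClosed (S : Set (holAut (⊤ : Opens X))) ∧ Nonempty (S ≃ₜ Circle))) := by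
  letI := homeoCompactOpen (⊤ : Opens X)
  obtain ⟨⟨e⟩, -⟩ := discHolAutIsoPSL2R_holds X hX
  exact oneParameterSubgroups_transfer e h

end Disc

/-! ### "The Riemann mapping theorem": simply connected planar domains are Aut-holomorphic discs -/

section Planar

/-- **Riemann-mapping discs in the plane.**  A simply connected open proper subset `Ω ⊊ ℂ`, with the
complex structure of an open subset of `ℂ`, is an Aut-holomorphic disc: the tree's Riemann mapping
theorem (`Complex.exists_bijOn_ball_differentiableOn_invFunOn`) packaged as a biholomorphic
homeomorphism `↥Ω ≃ₜ unitDiscOpens` ("the Riemann mapping theorem of elementary complex analysis"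
invoked in Cor. 2.7 (d)). [cite: MochizukiAbsTopIII2015, Corollary 2.7 (d) p.59] -/
theorem isAutHolDisc_of_isSimplyConnected (Ω : Opens ℂ) (hsc : IsSimplyConnected (Ω : Set ℂ))
    (hne : (Ω : Set ℂ) ≠ univ) : IsAutHolDisc Ω := by
  obtain ⟨f, hfd, hbij, hfinv⟩ :=
    Complex.exists_bijOn_ball_differentiableOn_invFunOn Ω.isOpen hsc hne
  set fi := invFunOn f (Ω : Set ℂ) with hfi
  have hfi_mem : ∀ {u : ℂ}, u ∈ ball (0 : ℂ) 1 → fi u ∈ (Ω : Set ℂ) := fun hu =>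
    invFunOn_mem (hbij.surjOn hu)
  have hfi_right : ∀ {u : ℂ}, u ∈ ball (0 : ℂ) 1 → f (fi u) = u := fun hu =>
    invFunOn_eq (hbij.surjOn hu)
  have hfi_left : ∀ {w : ℂ}, w ∈ (Ω : Set ℂ) → fi (f w) = w := fun hw =>
    hbij.injOn.leftInvOn_invFunOn hw
  have hmemF : ∀ p : Ω, f p ∈ unitDiscOpens := fun p => hbij.mapsTo p.2
  have hmemI : ∀ u : unitDiscOpens, fi u ∈ Ω := fun u => hfi_mem u.2
  let toF : Ω → unitDiscOpens := fun p => ⟨f p, hmemF p⟩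
  let invF : unitDiscOpens → Ω := fun u => ⟨fi u, hmemI u⟩
  have hcontF : Continuous toF :=
    (hfd.continuousOn.comp_continuous continuous_subtype_val fun p => p.2).subtype_mk hmemF
  have hcontI : Continuous invF :=
    (hfinv.continuousOn.comp_continuous continuous_subtype_val fun u => u.2).subtype_mk hmemI
  let eV : Ω ≃ₜ unitDiscOpens :=
    { toFun := toF
      invFun := invF
      left_inv := fun p => Subtype.ext (hfi_left p.2)
      right_inv := fun u => Subtype.ext (hfi_right u.2)
      continuous_toFun := hcontF
      continuous_invFun := hcontI }
  have hΦ : ∀ p : Ω, MDifferentiableAt 𝓘(ℂ, ℂ) 𝓘(ℂ, ℂ) f (p : ℂ) := fun p =>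
    mdifferentiableAt_iff_differentiableAt.2 (hfd.differentiableAt (Ω.isOpen.mem_nhds p.2))
  have hΨ : ∀ u : unitDiscOpens, MDifferentiableAt 𝓘(ℂ, ℂ) 𝓘(ℂ, ℂ) fi (u : ℂ) := fun u =>
    mdifferentiableAt_iff_differentiableAt.2 (hfinv.differentiableAt (isOpen_ball.mem_nhds u.2))
  refine ⟨eV, fun p => ?_, fun u => ?_⟩
  · exact (mdifferentiableAt_opens_iff (Ψ := eV) (Φ := f) (fun _ => rfl) p).2 (hΦ p)
  · exact (mdifferentiableAt_opens_iff (Ψ := eV.symm) (Φ := fi) (fun _ => rfl) u).2 (hΨ u)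

/-- A non-empty convex open proper subset of `ℂ` is an Aut-holomorphic disc (convex ⇒ contractible ⇒
simply connected, then `isAutHolDisc_of_isSimplyConnected`).
[cite: MochizukiAbsTopIII2015, Corollary 2.7 (d) p.59] -/
theorem isAutHolDisc_of_convex (Ω : Opens ℂ) (hc : Convex ℝ (Ω : Set ℂ))
    (hne : (Ω : Set ℂ).Nonempty) (hne' : (Ω : Set ℂ) ≠ univ) : IsAutHolDisc Ω := by
  haveI : ContractibleSpace (Ω : Set ℂ) := hc.contractibleSpace hne
  exact isAutHolDisc_of_isSimplyConnected Ω (SimplyConnectedSpace.ofContractible _) hne'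

/-- **The Aut-holomorphic space determined by a parallelogram is an Aut-holomorphic disc**: a
non-degenerate open parallelogram `{z + s v + t w | 0 < s, t < 1}` of the complex plane (the chart
picture of a parallelogram `V^top ⊆ E^top`, cf. Prop. 2.5 / Cor. 2.7 (c)), with the complex
structure of an open subset of `ℂ`, is biholomorphic to the unit disc ("the Riemann mapping
theorem of elementary complex analysis"). [cite: MochizukiAbsTopIII2015, Corollary 2.7 (d) p.59] -/
theorem isAutHolDisc_openParallelogram {z v w : ℂ} (hvw : LinearIndependent ℝ ![v, w]) :
    IsAutHolDisc (⟨openParallelogram z v w, isOpen_openParallelogram hvw⟩ : Opens ℂ) := by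
  refine isAutHolDisc_of_convex _ (convex_openParallelogram z v w) (openParallelogram_nonempty z v w)
    ?_
  intro h
  have hb : Bornology.IsBounded (closure (openParallelogram z v w)) :=
    (isCompact_closure_openParallelogram hvw).isBounded
  have : Bornology.IsBounded (univ : Set ℂ) := by
    refine hb.subset ?_
    show (univ : Set ℂ) ⊆ closure (openParallelogram z v w)
    rw [← h]
    exact subset_closure
  exact (NormedSpace.unbounded_univ ℝ ℂ) this

end Planar

/-! ### Cor. 2.7 (d) for the Aut-holomorphic space determined by a parallelogram -/

section Parallelogram

/-- **[AbsTopIII] Cor. 2.7 (d), first sentence, at the planar model** (modulo the named fact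
`OneParameterSubgroupsPSL2R`, consumed BY NAME): "Let `𝕍` be the Aut-holomorphic space determined
by a parallelogram `V^top` … Then the one-parameter subgroups of the [topological] group
`𝒜_𝕍(V^top)` [`≅ SL₂(ℝ)/{±1}` — cf. Proposition 2.2, (ii); Corollary 2.3, (i); the Riemann mapping
theorem …] are precisely the closed connected subgroups for which the complement of [the identity]
fails to be connected" — both clauses of the repaired reading, for `V^top = {z + s v + t w}` a
non-degenerate open parallelogram of the complex plane (an open `V ⊆ ℂ` with that carrier) and
`𝒜_𝕍(V^top) = Aut^hol(V)` with the compact-open topology.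
[cite: MochizukiAbsTopIII2015, Corollary 2.7 (d) p.59] -/
theorem oneParameterSubgroups_holAut_openParallelogram_of (h : OneParameterSubgroupsPSL2R)
    {z v w : ℂ} (hvw : LinearIndependent ℝ ![v, w]) (V : Opens ℂ)
    (hV : (V : Set ℂ) = openParallelogram z v w) :
    letI := homeoCompactOpen (⊤ : Opens V)
    (∀ S : Subgroup (holAut (⊤ : Opens V)),
        (∃ f : Multiplicative ℝ →* holAut (⊤ : Opens V),
            Continuous f ∧ Injective f ∧ f.range = S) ↔
        (IsClosed (S : Set (holAut (⊤ : Opens V))) ∧ IsConnected (S : Set (holAut (⊤ : Opens V))) ∧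
          ¬ IsPreconnected ((univ : Set S) \ {1}))) ∧
      (∀ S : Subgroup (holAut (⊤ : Opens V)),
        (∃ f : Multiplicative ℝ →* holAut (⊤ : Opens V),
            Continuous f ∧ ¬ Injective f ∧ f ≠ 1 ∧ f.range = S) ↔
        (IsClosed (S : Set (holAut (⊤ : Opens V))) ∧ Nonempty (S ≃ₜ Circle))) := by
  obtain rfl : V = ⟨openParallelogram z v w, isOpen_openParallelogram hvw⟩ := Opens.ext hV
  exact oneParameterSubgroups_holAut_of h _ (isAutHolDisc_openParallelogram hvw)

end Parallelogram

end Literature.AnabelianGeometry.AbsoluteAnabelian
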